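import Literature.Probability.LatticeModels.RandomClusterEdgeWeights
import HarnessLib

/-!
# Connectivity correlation inequalities for `φ_{w,q}`, every `q > 0` — file 11 (DEFINITION): the random-cluster mass of a
# sub-network

Definitions file (`--supports stmt-CriticalPhenomena-4575`), FK sub-lane `prim-bschramm-fk-2` (gen 7) of the post-continuity
programme; builds on p205010 (kernel theorem, internal audit signed; external expert review pending).  No named facts, no sorries.

* `FK.netMass w q E A = ∑_ω W_w(ω) · q^{k(ω ∩ E)} · 1_A(ω ∩ E)` — for a weight vector `w : Sym2 V → [0,1]`, a real `q`, an edge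
  set `E ⊆ Sym2 V` and an event `A`: the random-cluster mass of `A` for the SUB-NETWORK `E`, read on `ω ∩ E` under the ambient
  product weight `W_w` (`BHK2006.weight`, the density of `prodBernoulli w`), with the cluster factor `q^{k(ω ∩ E)}`
  (`k = clusterCount · ∅`, clusters counted on all of `V`; Grimmett 2006, eq. (1.20)).  With `A = {s ↔ t}` / `{s ↮ t}` these are
  the connected / disconnected two-terminal partition functions of `E` (up to the normalisation of the product measure), the
  quantities composed by the series/parallel laws of `…AllQSPLaw.lean`; for `w` supported in `E` they are the masses
  `S_w(A) = ∑_ω w_q(ω) 1_A(ω)` of `…AllQEdgeMono.lean` (`FK.sum_rcWeightW_ind_eq_netMass` there).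
[cite: Grimmett2006, §1.4 eq. (1.20) (p. 15); §3.8 (pp. 61–62)]
-/

noncomputable section

namespace Summit.CriticalPhenomena.PercolationContinuityZ3.Theorems

namespace FK

open Literature.Probability.LatticeModels Literature.Probability.Percolation
open Literature.Probability.Percolation.BHK2006 (weight)
open Literature.Probability.Percolation.DecisionTree (ind)
open scoped Classical

variable {V : Type*} [Fintype V]

/-- **Network mass** `netMass w q E A = ∑_ω W_w(ω) · q^{k(ω ∩ E)} · 1_A(ω ∩ E)`: the random-cluster mass of the event `A` for
the sub-network `E`, read on `ω ∩ E` under the product weight of `w`, clusters counted on all of `V` (Grimmett 2006, (1.20)).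
[cite: Grimmett2006, §1.4 eq. (1.20) (p. 15)] -/
def netMass (w : Sym2 V → unitInterval) (q : ℝ) (E : Set (Sym2 V)) (A : Set (BondConfig V)) : ℝ :=
  ∑ ω : BondConfig V, weight (fun e => (w e : ℝ)) ω * (q ^ clusterCount (ω ∩ E) ∅ * ind A (ω ∩ E))

end FK

end Summit.CriticalPhenomena.PercolationContinuityZ3.Theorems

end
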